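import Summits.BirchSwinnertonDyer.BirchSwinnertonDyer.Theorems.UniversalToricDescentSigmaLocalTransport
import Mathlib.GroupTheory.PGroup
import HarnessLib

/-!
# Route UniversalToricDescent — the local terms are FINITE `3`-powers, and the localised algebraic half
# of 21845 in Greenberg–Vatsal's additive currency: `λ_alg(E) + Σ_{v∈Σ} 3^{c_v} s_v(E) = n′ + Σ_{v∈Σ} 3^{c_v} s_v(E′)`

Lead prover bsd-wall-utd-p1 g8 (`--supports stmt-BirchSwinnertonDyer-20399`; memo ALG-HALF-21845-LOCAL
§2–§3). `UniversalToricDescentSigmaLocalTransport.invariantsTransportT_algebraicHalf_local` is an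
identity of `Nat.card`s; this file certifies it is non-degenerate and converts it to exponents:

* §1 `finite_pTorsion_subgroupH1_kerD` — at `v ∤ p` finitely decomposed in `K_∞`, the `p`-torsion of
  `H¹(H ∩ D_v, E[p^∞])` (in the `kerD κ v ≤ D_v` currency of the local-image files) is FINITE: it
  injects into the tree's `H¹(ker κ ⊓ D_v, E[p^∞])[p]` (`UniversalToricDescentSigmaPassage`, from the
  prime-to-`p` tower over inertia) along the tautological isomorphism `ker κ ⊓ D_v ≅ kerD κ v`;
  `exists_natCard_pTorsion_subgroupH1_kerD_eq_pow` — hence `#H¹(H ∩ D_v, E[p^∞])[p] = p^{s_v}` for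
  some `s_v` (an elementary abelian `p`-group; GV's `s_v = corank_{ℤ_p} H¹(K_{∞,w_v}, E[p^∞])`).
* §2 **`invariantsTransportT_algebraicHalf_lambda`** — in the binders of 21845 (+ (iv), base finiteness
  ×2, Poitou–Tate ×2): `X_{∅,0}(E)` torsion, a generator with norm profile `λ_alg(E)`, the finite bad
  set `Σ` with exact indices `c_v` and local exponents `s_v(E)`, `s_v(E′)`, and
  **`λ_alg(E) + Σ_{v∈Σ} 3^{c_v}·s_v(E) = n′ + Σ_{v∈Σ} 3^{c_v}·s_v(E′)`** — Greenberg–Vatsal's Thm. (1.4)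
  shape `λ(𝓛^Σ) = λ(𝓛) + Σ_v 3^{c_v} s_v` on the algebraic side, curve by curve.

HONEST STATUS: helper theorems, CONDITIONAL on the cited Poitou–Tate facts and the twin's base
finiteness; the VALUE of `s_v` (GV Prop. 2.4: Frobenius on `(E[3^∞]^{P_q})_{I_q}(−1)`, i.e. the
`3`-adic roots of the Euler factor at `q`) is not computed here; analytic half and 20395 unchanged.
THEOREMS ONLY; no definition, no named fact, no `sorry`. BSD is not advanced by this file.
References: [GreenbergVatsal2000] Thm. (1.4), §2 Prop. (2.4), (2.10) (pp. 23–28); [GreenbergLNM1716]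
§3 Lemma 3.3 (p. 87); [Brink2007] Thm. 2.
-/

set_option autoImplicit false
-- `…BirchSwinnertonDyer.BirchSwinnertonDyer.Theorems…` is the problem's mandated namespace (D-0017).
set_option linter.dupNamespace false

noncomputable section

open scoped Classical

namespace Summit.BirchSwinnertonDyer.BirchSwinnertonDyer.Theorems.UniversalToricDescentSigmaLocalImage

open Function Field NumberField IsDedekindDomain WeierstrassCurve
open Literature.NumberTheory.GaloisRepresentations Literature.NumberTheory.EllipticCurves
  Literature.NumberTheory.EllipticCurves.GreenbergSelmer Literature.NumberTheory.GaloisCohomology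
  Literature.NumberTheory.EllipticCurves.IwasawaAlgebra Literature.NumberTheory.EllipticCurves.Rank1Residual
  Summit.BirchSwinnertonDyer.Rank1Residual Summit.BirchSwinnertonDyer.Rank1Residual.X11b
  Summit.BirchSwinnertonDyer.Rank1Residual.X11b.Coinv Summit.BirchSwinnertonDyer.Rank1Residual.X11b.AcSelmer
  Summit.BirchSwinnertonDyer.Rank1Residual.Iwasawa
  Summit.BirchSwinnertonDyer.BirchSwinnertonDyer.Theorems.UniversalToricDescentSigmaPassage

/-! ### §1 The local `p`-torsion is finite, of order a power of `p` -/

section Local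

variable {K : Type} [Field K] [NumberField K] (W : WeierstrassCurve K) [W.IsElliptic] {p : ℕ}
  [Fact p.Prime] (κ : ZpExtension K p)

omit [W.IsElliptic] in
/-- Restriction along the tautological isomorphism `ker κ ⊓ D_v → kerD κ v` (the same subgroup of `Γ_K`,
seen inside `Γ_K` resp. inside `D_v`) is injective on `H¹(·, M)`. [folklore] -/
theorem exists_injective_subgroupH1_kerD {M : Type} [AddCommGroup M]
    [DistribMulAction (absoluteGaloisGroup K) M] [TopologicalSpace M] [DiscreteTopology M]
    (v : HeightOneSpectrum (𝓞 K)) :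
    ∃ ρ : subgroupH1 (kerD κ v) M →+ subgroupH1 (κ.kerSubgroup ⊓ decomp v) M, Injective ρ := by
  let θ : (κ.kerSubgroup ⊓ decomp v : Subgroup (absoluteGaloisGroup K)) →ₜ* kerD κ v :=
    { toFun := fun x ↦ ⟨⟨(x : absoluteGaloisGroup K), (Subgroup.mem_inf.mp x.2).2⟩,
        (mem_kerD_iff κ v _).2 (Subgroup.mem_inf.mp x.2).1⟩
      map_one' := rfl
      map_mul' := fun _ _ ↦ rfl
      continuous_toFun := (continuous_subtype_val.subtype_mk _).subtype_mk _ }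
  have hθ : Surjective θ := fun d ↦
    ⟨⟨((d : decomp (K := K) v) : absoluteGaloisGroup K),
      Subgroup.mem_inf.mpr ⟨(mem_kerD_iff κ v _).1 d.2, (d : decomp (K := K) v).2⟩⟩, rfl⟩
  exact ⟨_, resH1Hom_injective_of_surjective θ hθ fun _ _ ↦ rfl⟩

/-- **`H¹(H ∩ D_v, E[p^∞])[p]` is finite** at a place `v ∤ p` finitely decomposed in `K_∞` (in the
`kerD κ v` currency of the local-image files): it injects into the tree's finite
`H¹(ker κ ⊓ D_v, E[p^∞])[p]` (`finite_pTorsion_subgroupH1_inf_decomp`).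
[cite: GreenbergLNM1716, §3 Lemma 3.3 (proof, p. 87)] [cite: GreenbergVatsal2000, §2 Prop. (2.4)] -/
theorem finite_pTorsion_subgroupH1_kerD {v : HeightOneSpectrum (𝓞 K)} (hpv : (p : 𝓞 K) ∉ v.asIdeal)
    (hv : ¬ (decomp v ≤ κ.kerSubgroup)) :
    Finite {f : subgroupH1 (kerD κ v) (W.geomPrimaryTorsion p) // p • f = 0} := by
  obtain ⟨ρ, hρ⟩ := exists_injective_subgroupH1_kerD κ (M := W.geomPrimaryTorsion p) v
  haveI := (finite_pTorsion_subgroupH1_inf_decomp W κ hpv hv).to_subtype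
  let j : {f : subgroupH1 (kerD κ v) (W.geomPrimaryTorsion p) // p • f = 0} →
      {c : W.subgroupH1 p (κ.kerSubgroup ⊓ decomp v) | p • c = 0} :=
    fun f ↦ ⟨ρ f.1, by
      show p • ρ f.1 = 0
      rw [← map_nsmul, f.2, map_zero]⟩
  exact Finite.of_injective j fun a b h ↦ Subtype.ext (hρ (congrArg Subtype.val h))

/-- **`#H¹(H ∩ D_v, E[p^∞])[p] = p^{s_v}` for some `s_v`** (a finite elementary abelian `p`-group).
Greenberg–Vatsal: `s_v = corank_{ℤ_p} H¹(K_{∞,w_v}, E[p^∞])`. [cite: GreenbergVatsal2000, §2 Prop. (2.4) (p. 24)] -/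
theorem exists_natCard_pTorsion_subgroupH1_kerD_eq_pow {v : HeightOneSpectrum (𝓞 K)}
    (hpv : (p : 𝓞 K) ∉ v.asIdeal) (hv : ¬ (decomp v ≤ κ.kerSubgroup)) :
    ∃ s : ℕ, Nat.card {f : subgroupH1 (kerD κ v) (W.geomPrimaryTorsion p) // p • f = 0} = p ^ s := by
  haveI := finite_pTorsion_subgroupH1_kerD W κ hpv hv
  -- the `p`-torsion as a subgroup
  let Tp : AddSubgroup (subgroupH1 (kerD κ v) (W.geomPrimaryTorsion p)) := AddSubgroup.torsionBy _ p
  have hTp : ∀ f, f ∈ Tp ↔ p • f = 0 := fun f ↦ AddSubgroup.torsionBy.nsmul_iff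
  have e : Nat.card {f : subgroupH1 (kerD κ v) (W.geomPrimaryTorsion p) // p • f = 0} = Nat.card Tp :=
    Nat.card_congr (Equiv.subtypeEquivRight fun f ↦ (hTp f).symm)
  haveI : Finite Tp := Nat.finite_of_card_ne_zero (by
    rw [← e]
    haveI : Nonempty {f : subgroupH1 (kerD κ v) (W.geomPrimaryTorsion p) // p • f = 0} :=
      ⟨⟨0, smul_zero p⟩⟩
    exact Nat.card_pos.ne')
  have hP : IsPGroup p (Multiplicative Tp) := by
    intro g
    refine ⟨1, ?_⟩
    rw [pow_one]
    apply Multiplicative.toAdd.injective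
    rw [toAdd_pow, toAdd_one]
    exact Subtype.ext (by
      rw [AddSubgroupClass.coe_nsmul, ZeroMemClass.coe_zero]
      exact (hTp _).mp g.toAdd.2)
  obtain ⟨s, hs⟩ := (IsPGroup.iff_card).mp hP
  exact ⟨s, by rw [e]; exact hs⟩

end Local

/-! ### §2 The localised algebraic half of 21845 in the additive λ-currency -/

open Summit.BirchSwinnertonDyer.Rank1Residual.X11b.LocBridge
  Summit.BirchSwinnertonDyer.BirchSwinnertonDyer.Theorems.UniversalToricDescentTorsionMuTransportHeegner in
/-- **`λ_alg(E) + Σ_{v∈Σ} 3^{c_v}·s_v(E) = n′ + Σ_{v∈Σ} 3^{c_v}·s_v(E′)`.** In the binders of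
`invariantsTransportT_algebraicHalf_local` (21845 + (iv) + base finiteness for `E` and `E′` +
Poitou–Tate ×2): there are the finite bad set `Σ` (places `v ∤ 3` where `E_K` or `E′_K` is bad), exact
indices `c_v` (`3^{c_v}` places of `K_∞` above `v`) and local exponents with
`#H¹(H ∩ D_v, E[3^∞])[3] = 3^{s_v}`, `#H¹(H ∩ D_v, E′[3^∞])[3] = 3^{s′_v}`, such that `X_{∅,0}(E)` is
torsion, its characteristic ideal has a generator with norm profile `λ_alg(E)`, and
`λ_alg(E) + Σ_{v∈Σ} 3^{c_v} s_v = n′ + Σ_{v∈Σ} 3^{c_v} s′_v`.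
[cite: GreenbergVatsal2000, Thm. (1.4), §2 Prop. (2.4) and (2.10) (pp. 23–28)] [cite: Brink2007, Thm. 2 and Cor. 1] -/
theorem invariantsTransportT_algebraicHalf_lambda (W W' : WeierstrassCurve ℚ) [W.IsElliptic]
    [W.IsGloballyMinimal] [W'.IsElliptic] [W'.IsGloballyMinimal] {N N' : ℕ} (K : Type) [Field K]
    [NumberField K]
    (hO6 : Additive.ClassO6 W 3) (hN : W.conductorNorm ℤ = N) (hcong : O6.ModPCongruent W' W 3)
    (hN' : W'.conductorNorm ℤ = N') (hK : IsImaginaryQuadratic K)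
    (hHe : SatisfiesHeegnerHypothesis N K) (hHe' : SatisfiesHeegnerHypothesis N' K)
    (κ : ZpExtension K 3) (hκ : κ.IsAnticyclotomic) (γ : absoluteGaloisGroup K)
    [Fact (κ.IsTopGenerator γ)] {𝔭' : HeightOneSpectrum (𝓞 K)} (h𝔭' : ((3 : ℕ) : 𝓞 K) ∈ 𝔭'.asIdeal)
    (hT' : Module.IsTorsion (IwasawaAlgebra 3) (XAc (W'.baseChange K) 3 κ 𝔭' ∅ γ))
    {L' : UnrSeries 3} {n' : ℕ}
    (hL' : (XAc.charIdeal (W'.baseChange K) 3 κ 𝔭' ∅ γ).map (PowerSeries.map (Halves.toUnr 3)) =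
      Ideal.span {L'})
    (hn' : (∀ i < n', ‖((PowerSeries.coeff i L' : unrIntegers 3) : ℂ_[3])‖ < 1) ∧
      ‖((PowerSeries.coeff n' L' : unrIntegers 3) : ℂ_[3])‖ = 1)
    (h4 : ∀ R : (W.baseChange ℚ_[3]).toAffine.Point, 3 • R = 0 → R = 0)
    (hPT : poitouTate_selmerStructure_duality K) (hPT2 : poitouTate_sha_tateDual K)
    (hfin : ∀ v : HeightOneSpectrum (𝓞 K), ((3 : ℕ) : 𝓞 K) ∈ v.asIdeal →
      Finite (selmerAcBase (W.baseChange K) 3 v ∅))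
    (hfin' : ∀ v : HeightOneSpectrum (𝓞 K), ((3 : ℕ) : 𝓞 K) ∈ v.asIdeal →
      Finite (selmerAcBase (W'.baseChange K) 3 v ∅)) :
    ∃ (T : Finset (HeightOneSpectrum (𝓞 K))) (c s s' : HeightOneSpectrum (𝓞 K) → ℕ),
      (↑T = {v : HeightOneSpectrum (𝓞 K) | ((3 : ℕ) : 𝓞 K) ∉ v.asIdeal ∧
        (¬ (W.baseChange K).HasGoodReductionAt v ∨ ¬ (W'.baseChange K).HasGoodReductionAt v)}) ∧
      (∀ v ∈ T, (∃ d₀ : decomp (K := K) v, (κ (d₀ : absoluteGaloisGroup K)).toAdd = (3 : ℤ_[3]) ^ c v) ∧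
        (∀ d : decomp (K := K) v, (3 : ℤ_[3]) ^ c v ∣ (κ (d : absoluteGaloisGroup K)).toAdd) ∧
        Nat.card {f : subgroupH1 (kerD κ v) ((W.baseChange K).geomPrimaryTorsion 3) // 3 • f = 0} =
          3 ^ s v ∧
        Nat.card {f : subgroupH1 (kerD κ v) ((W'.baseChange K).geomPrimaryTorsion 3) // 3 • f = 0} =
          3 ^ s' v) ∧
      Module.IsTorsion (IwasawaAlgebra 3) (XAc (W.baseChange K) 3 κ 𝔭' ∅ γ) ∧
      (∃ g : UnrSeries 3,
        (XAc.charIdeal (W.baseChange K) 3 κ 𝔭' ∅ γ).map (PowerSeries.map (Halves.toUnr 3)) =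
            Ideal.span {g} ∧
          (∀ i < lambdaInvariant 3 (XAc (W.baseChange K) 3 κ 𝔭' ∅ γ),
            ‖((PowerSeries.coeff i g : unrIntegers 3) : ℂ_[3])‖ < 1) ∧
          ‖((PowerSeries.coeff (lambdaInvariant 3 (XAc (W.baseChange K) 3 κ 𝔭' ∅ γ)) g :
            unrIntegers 3) : ℂ_[3])‖ = 1) ∧
      lambdaInvariant 3 (XAc (W.baseChange K) 3 κ 𝔭' ∅ γ) + ∑ v ∈ T, 3 ^ c v * s v =
        n' + ∑ v ∈ T, 3 ^ c v * s' v := by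
  haveI : Fact (Nat.Prime 3) := ⟨Nat.prime_three⟩
  obtain ⟨T, c, hT, hcT, hTor, g, hg, hglt, hgeq, hcount⟩ :=
    invariantsTransportT_algebraicHalf_local W W' K hO6 hN hcong hN' hK hHe hHe' κ hκ γ h𝔭' hT' hL' hn'
      h4 hPT hPT2 hfin hfin'
  -- the places of `T` are prime to `3` and finitely decomposed
  have hTp : ∀ v ∈ T, ((3 : ℕ) : 𝓞 K) ∉ v.asIdeal := fun v hv ↦ by
    have h : v ∈ (↑T : Set (HeightOneSpectrum (𝓞 K))) := Finset.mem_coe.mpr hv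
    rw [hT] at h
    exact h.1
  have hTdec : ∀ v ∈ T, ¬ (decomp v ≤ κ.kerSubgroup) := by
    intro v hv hle
    obtain ⟨⟨d₀, hd₀⟩, -⟩ := hcT v hv
    have h1 : κ (d₀ : absoluteGaloisGroup K) = 1 := (ZpExtension.mem_kerSubgroup).mp (hle d₀.2)
    rw [h1, toAdd_one] at hd₀
    exact pow_ne_zero (c v) (by norm_num : (3 : ℤ_[3]) ≠ 0) hd₀.symm
  -- the local exponents
  choose! s hs using fun v (hv : v ∈ T) ↦
    exists_natCard_pTorsion_subgroupH1_kerD_eq_pow (W.baseChange K) κ (by exact_mod_cast hTp v hv)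
      (hTdec v hv)
  choose! s' hs' using fun v (hv : v ∈ T) ↦
    exists_natCard_pTorsion_subgroupH1_kerD_eq_pow (W'.baseChange K) κ (by exact_mod_cast hTp v hv)
      (hTdec v hv)
  refine ⟨T, c, s, s', hT, fun v hv ↦ ⟨(hcT v hv).1, (hcT v hv).2, hs v hv, hs' v hv⟩, hTor,
    ⟨g, hg, hglt, hgeq⟩, ?_⟩
  -- exponents from the `Nat.card` identity
  have e1 : ∏ v ∈ T, Nat.card {f : subgroupH1 (kerD κ v) ((W.baseChange K).geomPrimaryTorsion 3) //
      3 • f = 0} ^ (3 ^ c v) = 3 ^ ∑ v ∈ T, 3 ^ c v * s v := by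
    rw [← Finset.prod_pow_eq_pow_sum]
    exact Finset.prod_congr rfl fun v hv ↦ by rw [hs v hv, ← pow_mul, Nat.mul_comm (s v)]
  have e2 : ∏ v ∈ T, Nat.card {f : subgroupH1 (kerD κ v) ((W'.baseChange K).geomPrimaryTorsion 3) //
      3 • f = 0} ^ (3 ^ c v) = 3 ^ ∑ v ∈ T, 3 ^ c v * s' v := by
    rw [← Finset.prod_pow_eq_pow_sum]
    exact Finset.prod_congr rfl fun v hv ↦ by rw [hs' v hv, ← pow_mul, Nat.mul_comm (s' v)]
  rw [e1, e2, ← pow_add, ← pow_add] at hcount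
  exact Nat.pow_right_injective (by norm_num : 2 ≤ 3) hcount

open Summit.BirchSwinnertonDyer.BirchSwinnertonDyer.Theorems.UniversalToricDescentNoFiniteSubmodule in
/-- **`λ_alg(E) + Σ_{v∈Σ} 3^{c_v}·s_v(E) = n′ + Σ_{v∈Σ} 3^{c_v}·s_v(E′)` with the WILD curve's base finiteness
DISCHARGED from rank-one data** (`rank E(K) = 1`, `Ш(E/K)` finite, a point of infinite order — on the route,
Kolyvagin from the Heegner point; `finite_selmerAcBase_of_rankOne`); base finiteness for the twin `E′`
remains an input (steward note, memo §4). [cite: GreenbergVatsal2000, Thm. (1.4), §2 Prop. (2.4) and (2.10) (pp. 23–28)]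
[cite: JetchevSkinnerWan2017, Prop. 3.2.1 (arXiv:1512.06894 pp. 10–11)] -/
theorem invariantsTransportT_algebraicHalf_lambda_of_rankOne (W W' : WeierstrassCurve ℚ) [W.IsElliptic]
    [W.IsGloballyMinimal] [W'.IsElliptic] [W'.IsGloballyMinimal] {N N' : ℕ} (K : Type) [Field K]
    [NumberField K]
    (hO6 : Additive.ClassO6 W 3) (hN : W.conductorNorm ℤ = N) (hcong : O6.ModPCongruent W' W 3)
    (hN' : W'.conductorNorm ℤ = N') (hK : IsImaginaryQuadratic K)
    (hHe : SatisfiesHeegnerHypothesis N K) (hHe' : SatisfiesHeegnerHypothesis N' K)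
    (κ : ZpExtension K 3) (hκ : κ.IsAnticyclotomic) (γ : absoluteGaloisGroup K)
    [Fact (κ.IsTopGenerator γ)] {𝔭' : HeightOneSpectrum (𝓞 K)} (h𝔭' : ((3 : ℕ) : 𝓞 K) ∈ 𝔭'.asIdeal)
    (hT' : Module.IsTorsion (IwasawaAlgebra 3) (XAc (W'.baseChange K) 3 κ 𝔭' ∅ γ))
    {L' : UnrSeries 3} {n' : ℕ}
    (hL' : (XAc.charIdeal (W'.baseChange K) 3 κ 𝔭' ∅ γ).map (PowerSeries.map (Halves.toUnr 3)) =
      Ideal.span {L'})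
    (hn' : (∀ i < n', ‖((PowerSeries.coeff i L' : unrIntegers 3) : ℂ_[3])‖ < 1) ∧
      ‖((PowerSeries.coeff n' L' : unrIntegers 3) : ℂ_[3])‖ = 1)
    (h4 : ∀ R : (W.baseChange ℚ_[3]).toAffine.Point, 3 • R = 0 → R = 0)
    (hPT : poitouTate_selmerStructure_duality K) (hPT2 : poitouTate_sha_tateDual K)
    (hrank : (W.baseChange K).mordellWeilRank = 1) (hSha : (W.baseChange K).ShaFinite)
    (P : (W.baseChange K).toAffine.Point) (hP : ¬ IsOfFinAddOrder P)
    (hfin' : ∀ v : HeightOneSpectrum (𝓞 K), ((3 : ℕ) : 𝓞 K) ∈ v.asIdeal →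
      Finite (selmerAcBase (W'.baseChange K) 3 v ∅)) :
    ∃ (T : Finset (HeightOneSpectrum (𝓞 K))) (c s s' : HeightOneSpectrum (𝓞 K) → ℕ),
      (↑T = {v : HeightOneSpectrum (𝓞 K) | ((3 : ℕ) : 𝓞 K) ∉ v.asIdeal ∧
        (¬ (W.baseChange K).HasGoodReductionAt v ∨ ¬ (W'.baseChange K).HasGoodReductionAt v)}) ∧
      (∀ v ∈ T, (∃ d₀ : decomp (K := K) v, (κ (d₀ : absoluteGaloisGroup K)).toAdd = (3 : ℤ_[3]) ^ c v) ∧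
        (∀ d : decomp (K := K) v, (3 : ℤ_[3]) ^ c v ∣ (κ (d : absoluteGaloisGroup K)).toAdd) ∧
        Nat.card {f : subgroupH1 (kerD κ v) ((W.baseChange K).geomPrimaryTorsion 3) // 3 • f = 0} =
          3 ^ s v ∧
        Nat.card {f : subgroupH1 (kerD κ v) ((W'.baseChange K).geomPrimaryTorsion 3) // 3 • f = 0} =
          3 ^ s' v) ∧
      Module.IsTorsion (IwasawaAlgebra 3) (XAc (W.baseChange K) 3 κ 𝔭' ∅ γ) ∧
      (∃ g : UnrSeries 3,
        (XAc.charIdeal (W.baseChange K) 3 κ 𝔭' ∅ γ).map (PowerSeries.map (Halves.toUnr 3)) =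
            Ideal.span {g} ∧
          (∀ i < lambdaInvariant 3 (XAc (W.baseChange K) 3 κ 𝔭' ∅ γ),
            ‖((PowerSeries.coeff i g : unrIntegers 3) : ℂ_[3])‖ < 1) ∧
          ‖((PowerSeries.coeff (lambdaInvariant 3 (XAc (W.baseChange K) 3 κ 𝔭' ∅ γ)) g :
            unrIntegers 3) : ℂ_[3])‖ = 1) ∧
      lambdaInvariant 3 (XAc (W.baseChange K) 3 κ 𝔭' ∅ γ) + ∑ v ∈ T, 3 ^ c v * s v =
        n' + ∑ v ∈ T, 3 ^ c v * s' v := by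
  haveI : Fact (Nat.Prime 3) := ⟨Nat.prime_three⟩
  have hadd : Addv W 3 := hO6.2.1
  have hpN : 3 ∣ W.conductorNorm ℤ :=
    (W.dvd_conductorNorm_iff_not_hasGoodReductionAtPrime 3).mpr hadd.1
  have hsplit : SplitsIn K 3 := hHe 3 (Fact.out) (hN ▸ hpN)
  exact invariantsTransportT_algebraicHalf_lambda W W' K hO6 hN hcong hN' hK hHe hHe' κ hκ γ h𝔭' hT' hL'
    hn' h4 hPT hPT2 (finite_selmerAcBase_of_rankOne W 3 h4 hK hsplit hPT hrank hSha P hP) hfin'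

end Summit.BirchSwinnertonDyer.BirchSwinnertonDyer.Theorems.UniversalToricDescentSigmaLocalImage

end
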